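/-
Copyright: cell pub-balaban-gaps (YM BLITZ Y1, track G1), seat g1-p2 GEN 12 (unit `pub-balaban-gaps-g1-p2`).  Row (D4) NODE O, MODEL
level on 59b–66's carrier — ROAD (c′) of g1-plan-1 GEN 39 ((ψ5), backward half): the glued expansion of `(Δ_W + m² + a_KP_K(U))⁻¹` (130)
carries BOTH covariant difference letters at the background, K-free (`∇⁻_U(h⊗1) = (h(·−e)⊗1)∇⁻_U + ∇⁻h`, 99's `covDb`, 132's scheme).
HONEST FRAMING: as 130 ∕ 132 (local data, gauges, partition, penalties, forward AND backward agreement, units are hypothesis data);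
nothing of Bałaban's `Δ^{(k)}(𝐔)` is constructed; words of row (D4) UNCHANGED; (D4) instance 0∕1; NOT BetaPertH, NOT continuum, NOT Clay.
-/
import Summits.QuantumFields.BalabanUV.Gaps.D4WalkBlockGluedDerivative

/-!
# `Gaps.D4WalkBlockGluedDerivativeBackward` — the glued expansion of `(Δ_W + m² + a_KP_K(U))⁻¹` carries both covariant
# difference letters at `U` (cell pub-balaban-gaps, seat g1-p2 gen 12)

HONEST DEPENDENCY (cell pub-balaban, verbatim): continuum YM on T⁴ ⇐ BetaPertH ∧ nine spine estimates (0/9 proved); BetaPertH ⇐ (D1) ∧ (D4) ∧ CAP+tail.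
* §1 `Sbw_site`, `covDb_site`; §2 **`covDb_mul_wOp`** (`∇⁻_V(h⊗1) = (h(·−e_μ)⊗1)∇⁻_V + (∇⁻_μh⊗1)`), **`wOp_covDb_congr`**,
  `blockNorm_covDb_mul_le` (`‖∇⁻_{Ṽ}T‖ ≤ (1 + β)‖S⁻∂T‖ + β‖T‖`); §3 `covDb_mul_seed_eq`, `seed_covDerivB_rows`, **`seed_covDerivLetterB`**;
* §4 **`blockWalkExpansion_covOp_glued_covariant`** — 130's END with 55's derivative interface indexed by `((inl μ | inr μ), u₀ ∈ ball)`.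
WHAT IT IS NOT.  The weighted multi-level currency; OBJECT level untouched.  References: [B9] (3.6), (3.42), p. 398, (3.50), Cor. 3.6, (3.87)–(3.90).
-/

noncomputable section

namespace Summit.QuantumFields.BalabanUV.Gaps.D4WalkBlockGluedDerivativeBackward

open Metric Set Finset Matrix
open Literature.MathematicalPhysics.QuantumFieldTheory.Balaban1983to89
open Literature.MathematicalPhysics.QuantumFieldTheory.Balaban1983to89.B9SectDWalk (DomBy)
open Literature.MathematicalPhysics.QuantumFieldTheory.Balaban1983to89.B9Thm34Ext (toB6)
open Literature.MathematicalPhysics.QuantumFieldTheory.Balaban1983to89.B9Thm37GlueTorus (torusGeom tdist1)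
open Literature.MathematicalPhysics.QuantumFieldTheory.Balaban1983to89.TreeLengthTorus (TPt)
open Literature.MathematicalPhysics.QuantumFieldTheory.Balaban1983to89.B5TorusCover (UT)
open Literature.MathematicalPhysics.QuantumFieldTheory.Balaban1983to89.B11SectG (RowSum)
open Literature.MathematicalPhysics.QuantumFieldTheory.Balaban1983to89.B5Ineq137Torus (Nv blk)
open Literature.MathematicalPhysics.QuantumFieldTheory.Balaban1983to89.B10StarCount (shiftEquiv)
open Summit.QuantumFields.BalabanUV.Gaps.D4WalkBlock (blockNorm blockNorm_add_le BlockWalkExpansion)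
open Summit.QuantumFields.BalabanUV.Gaps.D4WalkBlockDerivative (blockWalkExpansion_perturb)
open Summit.QuantumFields.BalabanUV.Gaps.D4WalkBlockConjugate (blockNorm_local_mul_le blockNorm_mul_local_le)
open Summit.QuantumFields.BalabanUV.Gaps.D4WalkBlockFlatLetters (cubeOf)
open Summit.QuantumFields.BalabanUV.Gaps.D4WalkBlockShiftAlgebra (fibD Sbw Dfw)
open Summit.QuantumFields.BalabanUV.Gaps.D4WalkBlockShiftWeighted (wOp wOp_mul_fibD)
open Summit.QuantumFields.BalabanUV.Gaps.D4WalkBlockCovariantDerivative (covDf covDb covDb_mul_conj blockNorm_wcovDb_le wOp_mul_fibD_comm)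
open Summit.QuantumFields.BalabanUV.Gaps.D4WalkBlockCovariantGeometry (SBf shift_unshift)
open Summit.QuantumFields.BalabanUV.Gaps.D4WalkBlockCovariantShift (Df covDop covB)
open Summit.QuantumFields.BalabanUV.Gaps.D4WalkBlockCovariantPropagator (covOp)
open Summit.QuantumFields.BalabanUV.Gaps.D4WalkBlockCovariantBlockAveraging (PU)
open Summit.QuantumFields.BalabanUV.Gaps.D4WalkBlockSeedResummation (wOp_sub wOp_smul inv_eq_of_resummation)
open Summit.QuantumFields.BalabanUV.Gaps.D4WalkBlockCommutator388 (SBf_mul_wOp)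
open Summit.QuantumFields.BalabanUV.Gaps.D4WalkBlockSeedTerms (fibD_offCube PU_blockLocal rowSum_wOp_le)
open Summit.QuantumFields.BalabanUV.Gaps.D4WalkBlockSeedShapes (mul_fibD_apply_of_zero covOp_resummation_shapes)
open Summit.QuantumFields.BalabanUV.Gaps.D4WalkBlockPartitionSum
open Summit.QuantumFields.BalabanUV.Gaps.D4WalkBlockTruncatedSeeds (covB_nonneg seed_blockWalkExpansion step_blockWalkExpansion)
open Summit.QuantumFields.BalabanUV.Gaps.D4WalkBlockGluedDerivative (Dfw_site seed_covDerivLetter seed_covDeriv_rows)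

variable {P : Params} {F : Type} [Fintype F] [DecidableEq F]
variable {E : Type*}

section Weight
variable (Vi Vi' : Fin P.d → E → Site P 0 → Matrix F F ℂ)

omit [Fintype F] in
/-- `Sbw (Site P 0) F shiftEquiv μ = S⁻_μ`. -/
theorem Sbw_site (μ : Fin P.d) : Sbw (Site P 0) F (fun ν => shiftEquiv (P := P) (i := 0) ν) μ = SBf P F μ := rfl

/-- `∇⁻_{V,μ} = η⁻¹(1 − fibD(V⁻_μ(· − e_μ))·S⁻_μ)` on the fine torus. [cite: Balaban1985BackgroundPropagators, (3.6) p.391, (3.50) p.400] -/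
theorem covDb_site (μ : Fin P.d) (u : E) :
    covDb (fun ν => shiftEquiv (P := P) (i := 0) ν) P.eps Vi μ u
      = (P.eps : ℂ)⁻¹ • (1 - fibD (Site P 0) F (fun x => Vi μ u (Site.unshift x μ)) * SBf P F μ) := rfl

/-- **`∇⁻_{V,μ}·(h⊗1) = (h(·−e_μ)⊗1)·∇⁻_{V,μ} + (∇⁻_μh⊗1)`** (`∇⁻_μh(y) = η⁻¹(h(y) − h(y−e_μ))`). ([folklore]) -/
theorem covDb_mul_wOp (h : Site P 0 → ℝ) (μ : Fin P.d) (u : E) :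
    covDb (fun ν => shiftEquiv (P := P) (i := 0) ν) P.eps Vi μ u * wOp (Site P 0) F h
      = wOp (Site P 0) F (fun y => h (Site.unshift y μ)) * covDb (fun ν => shiftEquiv (P := P) (i := 0) ν) P.eps Vi μ u
        + wOp (Site P 0) F (fun y => P.eps⁻¹ * (h y - h (Site.unshift y μ))) := by
  have e3 : wOp (Site P 0) F (fun y => P.eps⁻¹ * (h y - h (Site.unshift y μ)))
      = (P.eps : ℂ)⁻¹ • (wOp (Site P 0) F h - wOp (Site P 0) F (fun y => h (Site.unshift y μ))) := by
    rw [← wOp_sub, ← Complex.ofReal_inv, ← wOp_smul]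
  rw [covDb_site, e3, Matrix.smul_mul, Matrix.mul_smul, Matrix.sub_mul, Matrix.one_mul, Matrix.mul_sub, Matrix.mul_one,
    Matrix.mul_assoc, SBf_mul_wOp, ← Matrix.mul_assoc, ← wOp_mul_fibD_comm, ← smul_add]
  congr 1
  simp only [Matrix.mul_assoc]
  abel

/-- **ROW AGREEMENT**: `(k⊗1)·∇⁻_{V,μ}·M = (k⊗1)·∇⁻_{V′,μ}·M` when `V⁻_μ(u, x − e_μ) = V′⁻_μ(u, x − e_μ)` wherever `k(x) ≠ 0`. ([folklore]) -/
theorem wOp_covDb_congr (k : Site P 0 → ℝ) (μ : Fin P.d) (u : E)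
    (hV : ∀ x, k x ≠ 0 → Vi μ u (Site.unshift x μ) = Vi' μ u (Site.unshift x μ)) (M : Matrix (Site P 0 × F) (Site P 0 × F) ℂ) :
    wOp (Site P 0) F k * covDb (fun ν => shiftEquiv (P := P) (i := 0) ν) P.eps Vi μ u * M
      = wOp (Site P 0) F k * covDb (fun ν => shiftEquiv (P := P) (i := 0) ν) P.eps Vi' μ u * M := by
  have key : wOp (Site P 0) F k * fibD (Site P 0) F (fun x => Vi μ u (Site.unshift x μ))
      = wOp (Site P 0) F k * fibD (Site P 0) F (fun x => Vi' μ u (Site.unshift x μ)) := by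
    rw [wOp_mul_fibD, wOp_mul_fibD]
    congr 1; funext x
    by_cases hk : k x = 0
    · simp [hk]
    · rw [hV x hk]
  rw [covDb_site, covDb_site, Matrix.mul_smul, Matrix.mul_smul, Matrix.mul_sub, Matrix.mul_sub, ← Matrix.mul_assoc (wOp _ _ k),
    ← Matrix.mul_assoc (wOp _ _ k), key]

/-- **THE BLOCK LETTER OF `∇⁻_{Ṽ,μ}T` FROM THE FLAT ONES** (99 `blockNorm_wcovDb_le` at `w ≡ 1`, `Λ = 1`): window
`Σ_b‖(Ṽ⁻_μ(u,y) − 1)_{ab}‖ ≤ ηβ` ⟹ `‖∇⁻_{Ṽ,μ}T‖_{y,y′} ≤ (1 + β)‖S⁻_μ∂_μT‖_{y,y′} + β‖T‖_{y,y′}`.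
[cite: Balaban1985BackgroundPropagators, Thm 3.1 (3.42) p.397, (3.37) p.396] -/
theorem blockNorm_covDb_mul_le {ν' : ℕ} {Kv : Fin ν' → ℕ} (cub : Site P 0 → UT Kv) (μ : Fin P.d) (u : E) {β : ℝ} (hβ : 0 ≤ β)
    (hV : ∀ y a, ∑ b, ‖(Vi μ u y - 1) a b‖ ≤ P.eps * β) (T : Matrix (Site P 0 × F) (Site P 0 × F) ℂ) (Y Y' : UT Kv) :
    blockNorm (fun p : Site P 0 × F => cub p.1) (fun p : Site P 0 × F => cub p.1)
        (covDb (fun ν => shiftEquiv (P := P) (i := 0) ν) P.eps Vi μ u * T) Y Y'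
      ≤ (1 + β) * blockNorm (fun p : Site P 0 × F => cub p.1) (fun p : Site P 0 × F => cub p.1) (SBf P F μ * Df P F μ * T) Y Y'
        + β * blockNorm (fun p : Site P 0 × F => cub p.1) (fun p : Site P 0 × F => cub p.1) T Y Y' := by
  have hε1 : P.eps ≤ 1 := by
    unfold Params.eps
    exact pow_le_one₀ (inv_nonneg.2 P.cast_L_pos.le) (inv_le_one_of_one_le₀ (by exact_mod_cast P.hL.2.le))
  have h1 : wOp (Site P 0) F (fun _ => (1 : ℝ)) = 1 := by
    unfold wOp; simp only [Complex.ofReal_one, one_smul]; exact D4WalkBlockGaugeAlgebra.fibD_const_one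
  have h := blockNorm_wcovDb_le (sh := fun ν => shiftEquiv (P := P) (i := 0) ν) (η := P.eps) (Ui := Vi) (w := fun _ => (1 : ℝ)) cub μ
    P.eps_pos (fun _ => zero_lt_one) (fun _ => by rw [mul_one]; exact hε1) zero_le_one (fun _ => by rw [one_mul]) hβ u
    (fun y a => by rw [mul_one]; exact hV y a) T Y Y'
  simp only [h1, one_pow, one_mul, Dfw_site, Sbw_site] at h
  exact h

variable (Vil : Fin P.d → E → Site P 0 → Matrix F F ℂ) (g gi : Site P 0 → Matrix F F ℂ) (h : Site P 0 → ℝ)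

/-- the algebra: `∇⁻_V·(fibD(hĝ⁻¹)·T·fibD(hĝ)) = fibD ĝ⁻¹·((h(·−e)⊗1)·∇⁻_{V^ĝ}·(T·(h⊗1)))·fibD ĝ + (∇⁻h⊗1)·(fibD ĝ⁻¹·(T·(h⊗1))·fibD ĝ)`. -/
theorem covDb_mul_seed_eq (hg : ∀ x, g x * gi x = 1) (hgi : ∀ x, gi x * g x = 1) (μ : Fin P.d) (u₀ : E)
    (T : Matrix (Site P 0 × F) (Site P 0 × F) ℂ) :
    covDb (fun ν => shiftEquiv (P := P) (i := 0) ν) P.eps Vi μ u₀ *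
        (fibD (Site P 0) F (fun x => (((h x : ℝ) : ℂ)) • gi x) * T * fibD (Site P 0) F (fun x => (((h x : ℝ) : ℂ)) • g x))
      = fibD (Site P 0) F gi * (wOp (Site P 0) F (fun y => h (Site.unshift y μ)) *
          covDb (fun ν => shiftEquiv (P := P) (i := 0) ν) P.eps
            (fun ν u y => g (shiftEquiv (P := P) (i := 0) ν y) * Vi ν u y * gi y) μ u₀ *
          (T * wOp (Site P 0) F h)) * fibD (Site P 0) F g
        + wOp (Site P 0) F (fun y => P.eps⁻¹ * (h y - h (Site.unshift y μ))) *
          (fibD (Site P 0) F gi * (T * wOp (Site P 0) F h) * fibD (Site P 0) F g) := by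
  have e1 : fibD (Site P 0) F (fun x => (((h x : ℝ) : ℂ)) • gi x) * T * fibD (Site P 0) F (fun x => (((h x : ℝ) : ℂ)) • g x)
      = wOp (Site P 0) F h * (fibD (Site P 0) F gi * (T * wOp (Site P 0) F h) * fibD (Site P 0) F g) := by
    rw [← wOp_mul_fibD h gi, ← wOp_mul_fibD h g]; simp only [Matrix.mul_assoc]
  rw [e1, ← Matrix.mul_assoc, covDb_mul_wOp, Matrix.add_mul, Matrix.mul_assoc (wOp (Site P 0) F fun y => h (Site.unshift y μ)),
    covDb_mul_conj hg hgi μ u₀, D4WalkBlockSeedResummation.wOp_mul_conj,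
    ← Matrix.mul_assoc (wOp (Site P 0) F fun y => h (Site.unshift y μ))]

/-- **rows of `∇⁻_{V,μ}·(seed term)` vanish at the sites `x` with `h(x) = h(x − e_μ) = 0`.** ([folklore]) -/
theorem seed_covDerivB_rows (hg : ∀ x, g x * gi x = 1) (hgi : ∀ x, gi x * g x = 1) (μ : Fin P.d) (u₀ : E)
    (T : Matrix (Site P 0 × F) (Site P 0 × F) ℂ) (x : Site P 0) (hx : h x = 0) (hxs : h (Site.unshift x μ) = 0) (a : F) (q : Site P 0 × F) :
    (covDb (fun ν => shiftEquiv (P := P) (i := 0) ν) P.eps Vi μ u₀ *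
        (fibD (Site P 0) F (fun x => (((h x : ℝ) : ℂ)) • gi x) * T * fibD (Site P 0) F (fun x => (((h x : ℝ) : ℂ)) • g x))) (x, a) q
      = 0 := by
  rw [covDb_mul_seed_eq Vi g gi h hg hgi μ u₀ T, Matrix.add_apply, D4WalkBlockShiftWeighted.wOp_mul_apply]
  have h1 : (fibD (Site P 0) F gi * (wOp (Site P 0) F (fun y => h (Site.unshift y μ)) *
      covDb (fun ν => shiftEquiv (P := P) (i := 0) ν) P.eps
        (fun ν u y => g (shiftEquiv (P := P) (i := 0) ν y) * Vi ν u y * gi y) μ u₀ *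
      (T * wOp (Site P 0) F h)) * fibD (Site P 0) F g) (x, a) q = 0 := by
    rw [Matrix.mul_apply]
    refine Finset.sum_eq_zero fun k _ => ?_
    rw [Matrix.mul_apply, Finset.sum_eq_zero, zero_mul]
    intro m _
    unfold fibD
    rw [Matrix.of_apply]
    split_ifs with h1
    · have e : m = (x, m.2) := Prod.ext h1.symm rfl
      rw [e, Matrix.mul_assoc, D4WalkBlockShiftWeighted.wOp_mul_apply, hxs, Complex.ofReal_zero, zero_mul, mul_zero]
    · rw [zero_mul]
  rw [h1, zero_add, hxs, hx, sub_zero, mul_zero, Complex.ofReal_zero, zero_mul]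

/-- **THE BACKWARD COVARIANT LETTER OF A SEED TERM** (132's `seed_covDerivLetter` with the BACKWARD agreement where `h(x − e_μ) ≠ 0`,
`|∇⁻_μh| ≤ δ₁`, the flat letter `‖S⁻_μ∂_μT‖ ≤ B₁F`): `‖∇⁻_{V(u₀),μ}·fibD(hĝ⁻¹)·T·fibD(hĝ)‖ ≤ r_g²((1 + β)B₁ + β + δ₁)·F`.
[cite: Balaban1985BackgroundPropagators, Thm 3.1 (3.42) p.397, p.398, Cor. 3.6 p.408] -/
theorem seed_covDerivLetterB (hg : ∀ x, g x * gi x = 1) (hgi : ∀ x, gi x * g x = 1) {rg : ℝ} (hrg : 0 ≤ rg)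
    (hgr : ∀ x a', ∑ b', ‖g x a' b'‖ ≤ rg) (hgir : ∀ x a', ∑ b', ‖gi x a' b'‖ ≤ rg) (hh1 : ∀ x, |h x| ≤ 1) {δ₁ : ℝ} (hδ₁ : 0 ≤ δ₁)
    (μ : Fin P.d) (hdm : ∀ y, |P.eps⁻¹ * (h y - h (Site.unshift y μ))| ≤ δ₁) (u₀ : E) {β : ℝ} (hβ : 0 ≤ β)
    (hagree : ∀ x, h (Site.unshift x μ) ≠ 0 →
      g x * Vi μ u₀ (Site.unshift x μ) * gi (Site.unshift x μ) = Vil μ u₀ (Site.unshift x μ))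
    (hVl : ∀ y a, ∑ b, ‖(Vil μ u₀ y - 1) a b‖ ≤ P.eps * β)
    (T : Matrix (Site P 0 × F) (Site P 0 × F) ℂ) {Fb : UT (Nv P P.K) → UT (Nv P P.K) → ℝ} {B₁ : ℝ}
    (hT : ∀ y y', blockNorm (fun q : Site P 0 × F => cubeOf P q.1) (fun q => cubeOf P q.1) T y y' ≤ Fb y y')
    (hDT : ∀ y y', blockNorm (fun q : Site P 0 × F => cubeOf P q.1) (fun q => cubeOf P q.1) (SBf P F μ * Df P F μ * T) y y' ≤
      B₁ * Fb y y') (y y' : UT (Nv P P.K)) :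
    blockNorm (fun q : Site P 0 × F => cubeOf P q.1) (fun q => cubeOf P q.1)
        (covDb (fun ν => shiftEquiv (P := P) (i := 0) ν) P.eps Vi μ u₀ *
          (fibD (Site P 0) F (fun x => (((h x : ℝ) : ℂ)) • gi x) * T * fibD (Site P 0) F (fun x => (((h x : ℝ) : ℂ)) • g x))) y y'
      ≤ rg * rg * ((1 + β) * B₁ + β + δ₁) * Fb y y' := by
  set cq : Site P 0 × F → UT (Nv P P.K) := fun q => cubeOf P q.1 with hcq
  have hloc : ∀ (w : Site P 0 → Matrix F F ℂ) (i j : Site P 0 × F), cq i ≠ cq j → fibD (Site P 0) F w i j = 0 :=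
    fun w i j hne => fibD_offCube P F w i j hne
  have hwloc : ∀ (w : Site P 0 → ℝ) (i j : Site P 0 × F), cq i ≠ cq j → wOp (Site P 0) F w i j = 0 := fun w i j hne => by
    unfold wOp; exact fibD_offCube P F _ i j hne
  have hM : ∀ z z', blockNorm cq cq (T * wOp (Site P 0) F h) z z' ≤ Fb z z' := fun z z' =>
    (blockNorm_mul_local_le cq cq T _ (hwloc h) zero_le_one (rowSum_wOp_le P F h hh1) z z').trans (by rw [mul_one]; exact hT z z')
  have hDM : ∀ z z', blockNorm cq cq (SBf P F μ * Df P F μ * (T * wOp (Site P 0) F h)) z z' ≤ B₁ * Fb z z' := fun z z' => by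
    rw [← Matrix.mul_assoc]
    exact (blockNorm_mul_local_le cq cq _ _ (hwloc h) zero_le_one (rowSum_wOp_le P F h hh1) z z').trans
      (by rw [mul_one]; exact hDT z z')
  have hrep : wOp (Site P 0) F (fun y => h (Site.unshift y μ)) *
      covDb (fun ν => shiftEquiv (P := P) (i := 0) ν) P.eps
        (fun ν u y => g (shiftEquiv (P := P) (i := 0) ν y) * Vi ν u y * gi y) μ u₀ * (T * wOp (Site P 0) F h)
      = wOp (Site P 0) F (fun y => h (Site.unshift y μ)) * covDb (fun ν => shiftEquiv (P := P) (i := 0) ν) P.eps Vil μ u₀ *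
        (T * wOp (Site P 0) F h) :=
    wOp_covDb_congr _ Vil (fun y => h (Site.unshift y μ)) μ u₀ (fun x hx => by
      have e : (shiftEquiv (P := P) (i := 0) μ) (Site.unshift x μ) = x := shift_unshift x μ
      simp only [e]; exact hagree x hx) _
  have h1 : blockNorm cq cq (fibD (Site P 0) F gi * (wOp (Site P 0) F (fun y => h (Site.unshift y μ)) *
      covDb (fun ν => shiftEquiv (P := P) (i := 0) ν) P.eps
        (fun ν u y => g (shiftEquiv (P := P) (i := 0) ν y) * Vi ν u y * gi y) μ u₀ *
      (T * wOp (Site P 0) F h)) * fibD (Site P 0) F g) y y' ≤ rg * rg * ((1 + β) * B₁ + β) * Fb y y' := by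
    rw [hrep]
    have hin : blockNorm cq cq (wOp (Site P 0) F (fun y => h (Site.unshift y μ)) *
        covDb (fun ν => shiftEquiv (P := P) (i := 0) ν) P.eps Vil μ u₀ * (T * wOp (Site P 0) F h)) y y' ≤ ((1 + β) * B₁ + β) * Fb y y' := by
      rw [Matrix.mul_assoc]
      refine (blockNorm_local_mul_le cq cq _ (hwloc _) zero_le_one (rowSum_wOp_le P F _ fun x => hh1 _) _ y y').trans ?_
      rw [one_mul]
      refine (blockNorm_covDb_mul_le Vil (cubeOf P) μ u₀ hβ hVl _ y y').trans ?_
      calc (1 + β) * blockNorm cq cq (SBf P F μ * Df P F μ * (T * wOp (Site P 0) F h)) y y' +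
            β * blockNorm cq cq (T * wOp (Site P 0) F h) y y'
          ≤ (1 + β) * (B₁ * Fb y y') + β * Fb y y' :=
            add_le_add (mul_le_mul_of_nonneg_left (hDM y y') (by positivity)) (mul_le_mul_of_nonneg_left (hM y y') hβ)
        _ = ((1 + β) * B₁ + β) * Fb y y' := by ring
    calc blockNorm cq cq (fibD (Site P 0) F gi * (wOp (Site P 0) F (fun y => h (Site.unshift y μ)) *
          covDb (fun ν => shiftEquiv (P := P) (i := 0) ν) P.eps Vil μ u₀ * (T * wOp (Site P 0) F h)) * fibD (Site P 0) F g) y y'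
        ≤ blockNorm cq cq (fibD (Site P 0) F gi * (wOp (Site P 0) F (fun y => h (Site.unshift y μ)) *
            covDb (fun ν => shiftEquiv (P := P) (i := 0) ν) P.eps Vil μ u₀ * (T * wOp (Site P 0) F h))) y y' * rg :=
          blockNorm_mul_local_le cq cq _ _ (hloc g) hrg (fun i => hgr i.1 i.2 |>.trans' (by rw [D4WalkBlockGaugeAlgebra.rowSum_fibD])) y y'
      _ ≤ rg * (((1 + β) * B₁ + β) * Fb y y') * rg :=
          mul_le_mul_of_nonneg_right ((blockNorm_local_mul_le cq cq _ (hloc gi) hrg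
            (fun i => hgir i.1 i.2 |>.trans' (by rw [D4WalkBlockGaugeAlgebra.rowSum_fibD])) _ y y').trans
            (mul_le_mul_of_nonneg_left hin hrg)) hrg
      _ = rg * rg * ((1 + β) * B₁ + β) * Fb y y' := by ring
  have h2 : blockNorm cq cq (wOp (Site P 0) F (fun y => P.eps⁻¹ * (h y - h (Site.unshift y μ))) *
      (fibD (Site P 0) F gi * (T * wOp (Site P 0) F h) * fibD (Site P 0) F g)) y y' ≤ δ₁ * (rg * rg * Fb y y') := by
    refine (blockNorm_local_mul_le cq cq _ (hwloc _) hδ₁ (rowSum_wOp_le P F _ hdm) _ y y').trans (mul_le_mul_of_nonneg_left ?_ hδ₁)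
    calc blockNorm cq cq (fibD (Site P 0) F gi * (T * wOp (Site P 0) F h) * fibD (Site P 0) F g) y y'
        ≤ blockNorm cq cq (fibD (Site P 0) F gi * (T * wOp (Site P 0) F h)) y y' * rg :=
          blockNorm_mul_local_le cq cq _ _ (hloc g) hrg (fun i => hgr i.1 i.2 |>.trans' (by rw [D4WalkBlockGaugeAlgebra.rowSum_fibD])) y y'
      _ ≤ rg * Fb y y' * rg := mul_le_mul_of_nonneg_right ((blockNorm_local_mul_le cq cq _ (hloc gi) hrg
            (fun i => hgir i.1 i.2 |>.trans' (by rw [D4WalkBlockGaugeAlgebra.rowSum_fibD])) _ y y').trans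
            (mul_le_mul_of_nonneg_left (hM y y') hrg)) hrg
      _ = rg * rg * Fb y y' := by ring
  rw [covDb_mul_seed_eq Vi g gi h hg hgi μ u₀ T]
  calc _ ≤ _ := blockNorm_add_le cq cq _ _ y y'
    _ ≤ rg * rg * ((1 + β) * B₁ + β) * Fb y y' + δ₁ * (rg * rg * Fb y y') := add_le_add h1 h2
    _ = rg * rg * ((1 + β) * B₁ + β + δ₁) * Fb y y' := by ring

end Weight

section End
variable {dd N' : ℕ} [NormedAddCommGroup E] [NormedSpace ℂ E] {B : Type} [Fintype B] [DecidableEq B]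
variable {c₀ : B13.Consts} {X : Finset (UT (Nv P P.K))} {R ε κ Kbar ρ δ₀ μr cμ : ℝ}
variable {W : B → Type} {T : (b : B) → W b → (TPt dd N' → ℂ) → E → Matrix (Site P 0 × F) (Site P 0 × F) ℂ}
variable {SX : (b : B) → Set (W b)} {A : (b : B) → W b → ℝ} {D : (b : B) → W b → UT (Nv P P.K) → UT (Nv P P.K) → ℝ}
variable {pen : B → UT (Nv P P.K) → ℝ} {N rg : ℝ}
variable {Wp Wm : Fin P.d → E → Site P 0 → Matrix F F ℂ} {Ug Ugi : E → Site P 0 → Matrix F F ℂ}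
variable {Wpl Wml : B → Fin P.d → E → Site P 0 → Matrix F F ℂ} {Ugl Ugil : B → E → Site P 0 → Matrix F F ℂ}
variable {a msq : ℝ} {g gi : B → Site P 0 → Matrix F F ℂ} {h : B → Site P 0 → ℝ} {S : B → Set (Site P 0)}
variable {δ₁ Λ β ω π θ : ℝ}

/-- **ROAD (c′) END WITH BOTH COVARIANT DIFFERENCE LETTERS AT THE BACKGROUND** ((ψ5) at one scale): 130's data plus the forward
agreement `ĝ_b(x)(1 + W⁺_μ(u₀,x))ĝ_b⁻¹(x+e_μ) = 1 + W̃⁺_{b,μ}(u₀,x)` where `h_b(x+e_μ) ≠ 0` and the backward one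
`ĝ_b(x)(1 + W⁻_μ(u₀,x))ĝ_b⁻¹(x−e_μ) = 1 + W̃⁻_{b,μ}(u₀,x)` where `h_b(x−e_μ) ≠ 0` ⟹ the glued expansion `Σ_ω T′_ω` of
`u ↦ (Δ_W(u) + m² + a_KP_K(U)(u))⁻¹` satisfies, for all `μ`, `u₀, u` in the ball, `‖∇_{U(u₀),μ}T′_ω(σ,u)‖ ≤ ((1+β)covB_{inl μ} + β + δ₁)A′_ωe^{−ρ′D′_ω}`
AND `‖∇⁻_{U(u₀),μ}T′_ω(σ,u)‖ ≤ ((1+β)covB_{inr μ} + β + δ₁)A′_ωe^{−ρ′D′_ω}`, `ρ′ = ρ − 2μ` — K-free. [cite: Balaban1985BackgroundPropagators, Thm 3.1 (3.42) p.397, p.398, (3.50) p.400, Cor. 3.6 p.408, (3.87)–(3.90) p.409; Balaban1988RG2Cluster, (1.11) p.5, p.15] -/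
theorem blockWalkExpansion_covOp_glued_covariant
    (hG : ∀ b, BlockWalkExpansion c₀ (fun q : Site P 0 × F => cubeOf P q.1) (fun q => cubeOf P q.1)
      (fun (_ : TPt dd N' → ℂ) u => (covOp P F (Wpl b) (Wml b) (PU P F (Ugl b) (Ugil b)) a msq u)⁻¹) X R ε κ Kbar (T b) (SX b)
      (A b) (D b) ρ)
    (hGD : ∀ b ι ω (σ : TPt dd N' → ℂ), (∀ j, ‖σ j‖ ≤ Real.exp c₀.κ₁) → ∀ u ∈ ball (0 : E) R, ∀ y y',
      blockNorm (fun q : Site P 0 × F => cubeOf P q.1) (fun q => cubeOf P q.1) (covDop P F ι * T b ω σ u) y y' ≤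
        covB P δ₀ ι * (A b ω * Real.exp (-(ρ * D b ω y y'))))
    (hGdom : ∀ b ω, DomBy (toB6 (torusGeom (Nv P P.K) 0 0 0) 0 True) (D b ω))
    (hερ : ε ≤ ρ) (hKbar : 0 ≤ Kbar) (hrg : 0 ≤ rg)
    (hgr : ∀ b x a', ∑ b', ‖g b x a' b'‖ ≤ rg) (hgir : ∀ b x a', ∑ b', ‖gi b x a' b'‖ ≤ rg) (hh1 : ∀ b x, |h b x| ≤ 1)
    (hpen0 : ∀ b y, 0 ≤ pen b y) (hpenh : ∀ b x, pen b (cubeOf P x) ≠ 0 → h b x = 0)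
    (hpenN : ∀ b x μ, pen b (cubeOf P x) ≠ 0 → h b (Site.shift x μ) = 0 ∧ h b (Site.unshift x μ) = 0)
    (hN : ∀ a, ∑ b, Real.exp (-((ρ - ε) * pen b a)) ≤ N)
    (hAhol : ∀ b p q, DifferentiableOn ℂ (fun u => covOp P F (Wpl b) (Wml b) (PU P F (Ugl b) (Ugil b)) a msq u p q) (ball (0 : E) R))
    (hδ₁ : 0 ≤ δ₁) (hΛ : 0 ≤ Λ) (hβ : 0 ≤ β) (hω : 0 ≤ ω) (hπ : 0 ≤ π)
    (hdp : ∀ b μ y, |P.eps⁻¹ * (h b (Site.shift y μ) - h b y)| ≤ δ₁)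
    (hdm : ∀ b μ y, |P.eps⁻¹ * (h b y - h b (Site.unshift y μ))| ≤ δ₁)
    (hlap : ∀ b μ y, |(P.eps⁻¹) ^ 2 * (h b (Site.shift y μ) - 2 * h b y + h b (Site.unshift y μ))| ≤ Λ)
    (hWpl : ∀ b μ, ∀ u ∈ ball (0 : E) R, ∀ x a', ∑ b', ‖Wpl b μ u x a' b'‖ ≤ P.eps * β)
    (hWml : ∀ b μ, ∀ u ∈ ball (0 : E) R, ∀ x a', ∑ b', ‖Wml b μ u x a' b'‖ ≤ P.eps * β)
    (hosc : ∀ b x x', blk P P.K x = blk P P.K x' → |h b x - h b x'| ≤ ω)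
    (hPUrow : ∀ b, ∀ u ∈ ball (0 : E) R, ∀ p, ∑ q, ‖PU P F (Ugl b) (Ugil b) u p q‖ ≤ π)
    (hθ : (∑ μ : Fin P.d, (1 + P.eps * β) * δ₁ * (covB P δ₀ (Sum.inl μ) + covB P δ₀ (Sum.inr μ))) +
      (P.d : ℝ) * (Λ + δ₁ * β + δ₁ * β) + |B1RG242Torus.α P a P.K| * (ω * π) ≤ θ)
    (hg : ∀ b x, g b x * gi b x = 1) (hgi : ∀ b x, gi b x * g b x = 1) (hhS : ∀ b y, y ∉ S b → h b y = 0)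
    (hsum : ∀ x, ∑ b, h b x ^ 2 = 1)
    (hp : ∀ u ∈ ball (0 : E) R, ∀ b μ y, y ∈ S b → Wpl b μ u (Site.unshift y μ) =
      g b (Site.unshift y μ) * (1 + Wp μ u (Site.unshift y μ)) * gi b (Site.shift (Site.unshift y μ) μ) - 1)
    (hm : ∀ u ∈ ball (0 : E) R, ∀ b μ y, y ∈ S b → Wml b μ u (Site.shift y μ) =
      g b (Site.shift y μ) * (1 + Wm μ u (Site.shift y μ)) * gi b (Site.unshift (Site.shift y μ) μ) - 1)
    (hUgi : ∀ u ∈ ball (0 : E) R, ∀ b x y, y ∈ S b → blk P P.K x = blk P P.K y → Ugil b u x = g b x * Ugi u x)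
    (hUg : ∀ u ∈ ball (0 : E) R, ∀ b y, y ∈ S b → Ugl b u y = Ug u y * gi b y)
    (hagreeD : ∀ u₀ ∈ ball (0 : E) R, ∀ b μ x, h b (Site.shift x μ) ≠ 0 →
      g b x * (1 + Wp μ u₀ x) * gi b (Site.shift x μ) = 1 + Wpl b μ u₀ x)
    (hagreeB : ∀ u₀ ∈ ball (0 : E) R, ∀ b μ x, h b (Site.unshift x μ) ≠ 0 →
      g b x * (1 + Wm μ u₀ x) * gi b (Site.unshift x μ) = 1 + Wml b μ u₀ x)
    (hA' : ∀ b, ∀ u ∈ ball (0 : E) R, IsUnit (covOp P F (Wpl b) (Wml b) (PU P F (Ugl b) (Ugil b)) a msq u).det)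
    (hunit : ∀ u ∈ ball (0 : E) R, IsUnit (1 - ∑ b, fibD (Site P 0) F (gi b) *
        ((wOp (Site P 0) F (h b) * covOp P F (Wpl b) (Wml b) (PU P F (Ugl b) (Ugil b)) a msq u -
            covOp P F (Wpl b) (Wml b) (PU P F (Ugl b) (Ugil b)) a msq u * wOp (Site P 0) F (h b)) *
          (covOp P F (Wpl b) (Wml b) (PU P F (Ugl b) (Ugil b)) a msq u)⁻¹) *
        fibD (Site P 0) F (fun x => (((h b x : ℝ) : ℂ)) • g b x)).det)
    (hμ : 0 ≤ μr) (hμε : 2 * μr ≤ ε) (hμκ : 2 * μr ≤ κ) (hwin : κ + μr ≤ ρ - ε) (hcμ : 0 ≤ cμ)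
    (hrow : RowSum (toB6 (torusGeom (Nv P P.K) 0 0 0) 0 True) μr cμ)
    (hq : cμ * (cμ * 1 * (1 * (N * (rg * rg * (θ * Kbar)))) * cμ) * cμ < 1) :
    ∃ (W' : Type) (T' : W' → (TPt dd N' → ℂ) → E → Matrix (Site P 0 × F) (Site P 0 × F) ℂ) (SX' : Set W') (A' : W' → ℝ)
      (D' : W' → UT (Nv P P.K) → UT (Nv P P.K) → ℝ),
      BlockWalkExpansion c₀ (fun q : Site P 0 × F => cubeOf P q.1) (fun q => cubeOf P q.1)
        (fun (_ : TPt dd N' → ℂ) u => (covOp P F Wp Wm (PU P F Ug Ugi) a msq u)⁻¹) X R (ε - 2 * μr) (κ - 2 * μr)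
        (cμ * (N * (rg * rg * Kbar)) * (1 * (1 - cμ * (cμ * 1 * (1 * (N * (rg * rg * (θ * Kbar)))) * cμ) * cμ)⁻¹) * cμ)
        T' SX' A' D' (ρ - 2 * μr) ∧
      (∀ μ, ∀ u₀ ∈ ball (0 : E) R, ∀ ω' (σ : TPt dd N' → ℂ), (∀ j, ‖σ j‖ ≤ Real.exp c₀.κ₁) → ∀ u ∈ ball (0 : E) R, ∀ y y',
        blockNorm (fun q : Site P 0 × F => cubeOf P q.1) (fun q => cubeOf P q.1)
            (covDf (fun ν => shiftEquiv (P := P) (i := 0) ν) P.eps (fun ν u x => 1 + Wp ν u x) μ u₀ * T' ω' σ u) y y' ≤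
          ((1 + β) * covB P δ₀ (Sum.inl μ) + β + δ₁) * (A' ω' * Real.exp (-((ρ - 2 * μr) * D' ω' y y')))) ∧
      (∀ μ, ∀ u₀ ∈ ball (0 : E) R, ∀ ω' (σ : TPt dd N' → ℂ), (∀ j, ‖σ j‖ ≤ Real.exp c₀.κ₁) → ∀ u ∈ ball (0 : E) R, ∀ y y',
        blockNorm (fun q : Site P 0 × F => cubeOf P q.1) (fun q => cubeOf P q.1)
            (covDb (fun ν => shiftEquiv (P := P) (i := 0) ν) P.eps (fun ν u y => 1 + Wm ν u (Site.shift y ν)) μ u₀ * T' ω' σ u)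
            y y' ≤
          ((1 + β) * covB P δ₀ (Sum.inr μ) + β + δ₁) * (A' ω' * Real.exp (-((ρ - 2 * μr) * D' ω' y y')))) ∧
      ∀ ω', DomBy (toB6 (torusGeom (Nv P P.K) 0 0 0) 0 True) (D' ω') := by
  have hθ0 : 0 ≤ θ := by
    have hc : ∀ ι, 0 ≤ covB P δ₀ ι := covB_nonneg δ₀
    have hηβ : 0 ≤ 1 + P.eps * β := by have := P.eps_pos; positivity
    refine le_trans (add_nonneg (add_nonneg (Finset.sum_nonneg fun μ _ => ?_) (by positivity)) (by positivity)) hθ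
    exact mul_nonneg (mul_nonneg hηβ hδ₁) (add_nonneg (hc _) (hc _))
  have hN0 : 0 ≤ N := le_trans (Finset.sum_nonneg fun b _ => (Real.exp_pos _).le) (hN (cubeOf P default))
  have hS := seed_blockWalkExpansion
    (Aloc := fun b u => covOp P F (Wpl b) (Wml b) (PU P F (Ugl b) (Ugil b)) a msq u) hG hερ hKbar hrg hgr hgir hh1 hpen0 hpenh hN
  have hR := step_blockWalkExpansion (PUl := fun b => PU P F (Ugl b) (Ugil b)) hG hGD hερ hKbar hrg hgr hgir hh1 hpen0 hpenh hpenN hN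
    hAhol hδ₁ hΛ hβ hω hπ hdp hdm hlap hWpl hWml (fun b u p q hne => PU_blockLocal P F (Ugl b) (Ugil b) u p q hne) hosc hPUrow hθ
  have hdomS := domBy_sum_localized (W := W) (D := D) hGdom hpen0
  have hBnn : ∀ p : (Fin P.d ⊕ Fin P.d) × ↥(ball (0 : E) R), 0 ≤ (1 + β) * covB P δ₀ p.1 + β + δ₁ := fun p => by
    have := covB_nonneg (P := P) δ₀ p.1; positivity
  have hDseed := derivLetters_sum_localized (cubq := fun q : Site P 0 × F => cubeOf P q.1)
    (T := fun b ω σ u => fibD (Site P 0) F (fun y => (((h b y : ℝ) : ℂ)) • gi b y) * T b ω σ u *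
      fibD (Site P 0) F (fun y => (((h b y : ℝ) : ℂ)) • g b y))
    (A := fun b ω => rg * rg * A b ω) (D := D) (pen := pen) (ρ := ρ)
    (fun p : (Fin P.d ⊕ Fin P.d) × ↥(ball (0 : E) R) =>
      Sum.elim (fun μ => covDf (fun ν => shiftEquiv (P := P) (i := 0) ν) P.eps (fun ν u x => 1 + Wp ν u x) μ p.2.1)
        (fun μ => covDb (fun ν => shiftEquiv (P := P) (i := 0) ν) P.eps (fun ν u y => 1 + Wm ν u (Site.shift y ν)) μ p.2.1) p.1)
    (fun p => (1 + β) * covB P δ₀ p.1 + β + δ₁)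
    (fun b ω => mul_nonneg (mul_nonneg hrg hrg) ((hG b).A_nonneg ω))
    (fun b (p : (Fin P.d ⊕ Fin P.d) × ↥(ball (0 : E) R)) ω σ hσ u hu y y' => by
      obtain ⟨ι, u₀⟩ := p
      cases ι with
      | inl μ =>
        simp only [Sum.elim_inl]
        have hl := seed_covDerivLetter (fun ν u x => 1 + Wp ν u x) (fun ν u x => 1 + Wpl b ν u x) (g b) (gi b) (h b) (hg b) (hgi b)
          hrg (hgr b) (hgir b) (hh1 b) hδ₁ μ (hdp b μ) u₀.1 hβ (fun x hx => hagreeD u₀.1 u₀.2 b μ x hx)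
          (fun x a' => by simp only [add_sub_cancel_left]; exact hWpl b μ u₀.1 u₀.2 x a') (T b ω σ u)
          ((hG b).majB ω σ hσ u hu) (fun y y' => hGD b (Sum.inl μ) ω σ hσ u hu y y') y y'
        exact hl.trans (le_of_eq (by ring))
      | inr μ =>
        simp only [Sum.elim_inr]
        have hl := seed_covDerivLetterB (fun ν u y => 1 + Wm ν u (Site.shift y ν)) (fun ν u y => 1 + Wml b ν u (Site.shift y ν))
          (g b) (gi b) (h b) (hg b) (hgi b) hrg (hgr b) (hgir b) (hh1 b) hδ₁ μ (hdm b μ) u₀.1 hβ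
          (fun x hx => by simp only [shift_unshift]; exact hagreeB u₀.1 u₀.2 b μ x hx)
          (fun y a' => by simp only [add_sub_cancel_left]; exact hWml b μ u₀.1 u₀.2 (Site.shift y μ) a') (T b ω σ u)
          ((hG b).majB ω σ hσ u hu) (fun y y' => hGD b (Sum.inr μ) ω σ hσ u hu y y') y y'
        exact hl.trans (le_of_eq (by ring)))
    (fun b (p : (Fin P.d ⊕ Fin P.d) × ↥(ball (0 : E) R)) ω σ _ u _ y y' hne => by
      obtain ⟨ι, u₀⟩ := p
      constructor
      · by_contra hpy
        refine hne (blockNorm_eq_zero_of_rows _ _ _ (fun i hi j => ?_) y')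
        have hx : pen b (cubeOf P i.1) ≠ 0 := by rw [show cubeOf P i.1 = y from hi]; exact hpy
        have e : i = (i.1, i.2) := rfl
        rw [e]
        cases ι with
        | inl μ =>
          simp only [Sum.elim_inl]
          exact seed_covDeriv_rows _ (g b) (gi b) (h b) (hg b) (hgi b) μ u₀.1 (T b ω σ u) i.1 (hpenh b i.1 hx)
            (hpenN b i.1 μ hx).1 i.2 j
        | inr μ =>
          simp only [Sum.elim_inr]
          exact seed_covDerivB_rows _ (g b) (gi b) (h b) (hg b) (hgi b) μ u₀.1 (T b ω σ u) i.1 (hpenh b i.1 hx)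
            (hpenN b i.1 μ hx).2 i.2 j
      · by_contra hpy
        refine hne (blockNorm_eq_zero_of_cols _ _ _ (fun j hj i => ?_) y)
        have hx : pen b (cubeOf P j.1) ≠ 0 := by rw [show cubeOf P j.1 = y' from hj]; exact hpy
        have hz : (fun y => (((h b y : ℝ) : ℂ)) • g b y) j.1 = 0 := by
          simp only [hpenh b j.1 hx, Complex.ofReal_zero, zero_smul]
        rw [← Matrix.mul_assoc]
        exact mul_fibD_apply_of_zero F _ _ j hz i)
    hBnn
  obtain ⟨W', T', SX', A', D', hBWE, hDer, hdom'⟩ := blockWalkExpansion_perturb (ι := (Fin P.d ⊕ Fin P.d) × ↥(ball (0 : E) R))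
    (Dop := (fun p : (Fin P.d ⊕ Fin P.d) × ↥(ball (0 : E) R) =>
      Sum.elim (fun μ => covDf (fun ν => shiftEquiv (P := P) (i := 0) ν) P.eps (fun ν u x => 1 + Wp ν u x) μ p.2.1)
        (fun μ => covDb (fun ν => shiftEquiv (P := P) (i := 0) ν) P.eps (fun ν u y => 1 + Wm ν u (Site.shift y ν)) μ p.2.1) p.1))
    (B := fun p => (1 + β) * covB P δ₀ p.1 + β + δ₁) (cub := fun q : Site P 0 × F => cubeOf P q.1) hS hdomS hBnn
    hDseed hR hdomS hμ hμε hμκ hwin (by positivity) (by positivity) hcμ hrow hq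
  refine ⟨W', T', SX', A', D', hBWE.congrK fun σ u _ hu => ?_,
    fun μ u₀ hu₀ ω' σ hσ u hu y y' => by simpa only [Sum.elim_inl] using hDer ⟨Sum.inl μ, ⟨u₀, hu₀⟩⟩ ω' σ hσ u hu y y',
    fun μ u₀ hu₀ ω' σ hσ u hu y y' => by simpa only [Sum.elim_inr] using hDer ⟨Sum.inr μ, ⟨u₀, hu₀⟩⟩ ω' σ hσ u hu y y', hdom'⟩
  exact inv_eq_of_resummation _ _ _ (covOp_resummation_shapes P F Wp Wm Ug Ugi a msq g gi Wpl Wml Ugl Ugil S h hg hgi hhS hsum u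
    (hp u hu) (hm u hu) (hUgi u hu) (hUg u hu) (fun b => hA' b u hu)) (hunit u hu)

end End

end Summit.QuantumFields.BalabanUV.Gaps.D4WalkBlockGluedDerivativeBackward

end
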